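import Literature.AlgebraicGeometry.Motives.SmoothHypersurfaceScheme
import Mathlib.AlgebraicGeometry.Geometrically.Irreducible
import Mathlib.RingTheory.Polynomial.UniqueFactorization
import Mathlib.Algebra.MvPolynomial.NoZeroDivisors
import HarnessLib

/-!
# The hypersurface of a geometrically irreducible form is geometrically irreducible

For a field `k` and a homogeneous form `F ∈ k[x₀, …, x_{n+1}]` which stays irreducible over every
field extension `K ⊇ k` (e.g. `k` algebraically closed and `F` irreducible by an argument that runs
over any overfield, as for the Fermat and chain forms of `Motives/HypersurfaceFormsIrreducible`), the
reduced hypersurface `X_F = V₊(F) → Spec k` of `Motives/SmoothHypersurfaceScheme` is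
**geometrically irreducible** (Mathlib `AlgebraicGeometry.GeometricallyIrreducible`):
`geometricallyIrreducible_hypersurface_hom`.

## Proof (Hartshorne II Ex. 3.15 with I Ex. 2.9 / II Ex. 2.9; Stacks 0366)

For a field extension `K/k`, the base change `X_F ×ₖ K` is a closed subscheme of
`ℙⁿ⁺¹_k ×ₖ K ≅ ℙⁿ⁺¹_K` (`Motives/BaseChangeProofs`: `isPullback_baseChange_map_left`,
`isPullback_projMap`) whose underlying set is the preimage of `V₊(F)`, i.e. `V₊(F_K)`
(`preimage_projMap_zeroLocus`). For `F_K` prime, `V₊(F_K)` is the closure of the point `(F_K)` of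
`Proj K[x]` (a relevant homogeneous prime: `pointOfPrime`), hence irreducible
(`isIrreducible_zeroLocus_of_prime`); a space homeomorphic (closed immersion) to an irreducible
subspace is irreducible.

## References

* R. Hartshorne, *Algebraic Geometry*, GTM 52 (1977): I Ex. 2.9, II Ex. 2.9, II Ex. 3.15.
  [Hartshorne1977]
* The Stacks project, Tag 0366 (geometrically irreducible schemes). [StacksProject]
-/

noncomputable section

open CategoryTheory AlgebraicGeometry MvPolynomial HomogeneousLocalization TopologicalSpace Limits

universe u

namespace Literature.AlgebraicGeometry.Motives.SmoothHypersurface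

open ProjectiveSpace

/-! ### `V₊(F)` is irreducible for `F` prime -/

section ZeroLocus

variable (K : Type u) [Field K] {n : ℕ}

attribute [local instance] MvPolynomial.gradedAlgebra

/-- A non-unit `F ∈ K[x₀, …, x_{n+1}]` does not divide two distinct variables; hence the irrelevant
ideal `(x₀, …, x_{n+1})` is not contained in `(F)`. [folklore] -/
theorem not_irrelevant_le_span_singleton {F : MvPolynomial (Fin (n + 2)) K} (hu : ¬ IsUnit F) :
    ¬ (HomogeneousIdeal.irrelevant (MvPolynomial.homogeneousSubmodule (Fin (n + 2)) K)).toIdeal ≤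
      Ideal.span {F} := by
  intro h
  have hdvd : ∀ i : Fin (n + 2), F ∣ X i := fun i =>
    Ideal.mem_span_singleton.mp (h (HomogeneousIdeal.mem_irrelevant_of_mem _ zero_lt_one (X_mem i)))
  obtain ⟨r, hr, h0 | h0⟩ := dvd_X_iff_exists.mp (hdvd 0)
  · exact hu (h0 ▸ hr.map C)
  obtain ⟨r', hr', h1 | h1⟩ := dvd_X_iff_exists.mp (hdvd 1)
  · exact hu (h1 ▸ hr'.map C)
  have h01 := congrArg (coeff (Finsupp.single (0 : Fin (n + 2)) 1)) (h0.symm.trans h1)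
  classical
  simp only [coeff_smul, coeff_X, if_true, smul_eq_mul, mul_one] at h01
  rw [if_neg (by simp [Finsupp.single_eq_single_iff])] at h01
  rw [h01, mul_zero] at hr
  exact not_isUnit_zero hr

variable {K}

/-- **The point `(F)` of `Proj K[x₀,…,x_{n+1}]`** for a prime homogeneous form `F`: the principal
ideal `(F)` is a relevant homogeneous prime (Hartshorne I Ex. 2.9 / II Ex. 2.9: irreducible
hypersurfaces correspond to irreducible forms; its closure is `V₊(F)`). [folklore] -/
def pointOfPrime {d : ℕ} (F : MvPolynomial (Fin (n + 2)) K) (hF : F.IsHomogeneous d)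
    (hprime : Prime F) : ProjectiveSpectrum (MvPolynomial.homogeneousSubmodule (Fin (n + 2)) K) where
  asHomogeneousIdeal :=
    ⟨Ideal.span {F}, Ideal.homogeneous_span _ _ fun x hx => ⟨d, by
      rw [Set.mem_singleton_iff.mp hx]; exact hF⟩⟩
  isPrime := (Ideal.span_singleton_prime hprime.ne_zero).mpr hprime
  not_irrelevant_le h := not_irrelevant_le_span_singleton K hprime.not_unit fun a ha => h ha

/-- `V₊(F)` is the closure of the point `(F)` (Mathlib `zeroLocus_vanishingIdeal_eq_closure`,
`vanishingIdeal_singleton`). [folklore] -/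
theorem zeroLocus_eq_closure_pointOfPrime {d : ℕ} (F : MvPolynomial (Fin (n + 2)) K)
    (hF : F.IsHomogeneous d) (hprime : Prime F) :
    ProjectiveSpectrum.zeroLocus (MvPolynomial.homogeneousSubmodule (Fin (n + 2)) K) {F} =
      closure {pointOfPrime F hF hprime} := by
  rw [← ProjectiveSpectrum.zeroLocus_vanishingIdeal_eq_closure,
    ProjectiveSpectrum.vanishingIdeal_singleton, ← ProjectiveSpectrum.zeroLocus_span]
  rfl

/-- **`V₊(F)` is irreducible for a prime form `F`** (closure of a point; Hartshorne I Ex. 2.9,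
II Ex. 2.9). [cite: Hartshorne1977, II Ex. 2.9] -/
theorem isIrreducible_zeroLocus_of_prime {d : ℕ} (F : MvPolynomial (Fin (n + 2)) K)
    (hF : F.IsHomogeneous d) (hprime : Prime F) :
    IsIrreducible (ProjectiveSpectrum.zeroLocus
      (MvPolynomial.homogeneousSubmodule (Fin (n + 2)) K) {F}) := by
  rw [zeroLocus_eq_closure_pointOfPrime F hF hprime]
  exact isIrreducible_singleton.closure

end ZeroLocus

/-! ### Base change of `V₊(F)` and geometric irreducibility -/

section BaseChange

variable (k K : Type u) [Field k] [Field K] [Algebra k K] {n : ℕ}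

attribute [local instance] MvPolynomial.gradedAlgebra ProjBaseChange.algebraBase

/-- Under `Proj K[x] → Proj k[x]` (base change), the preimage of `V₊(F)` is `V₊(F_K)`, `F_K` the image
of `F` in `K[x]` (Mathlib `Proj.map_preimage_basicOpen`, by complements). [folklore] -/
theorem preimage_projMap_zeroLocus (F : MvPolynomial (Fin (n + 2)) k) :
    (Proj.map (ProjBaseChange.mapGraded k K (Fin (n + 2))) (ProjBaseChange.irrelevant_le_map k K _))
        ⁻¹' ProjectiveSpectrum.zeroLocus (MvPolynomial.homogeneousSubmodule (Fin (n + 2)) k) {F} =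
      ProjectiveSpectrum.zeroLocus (MvPolynomial.homogeneousSubmodule (Fin (n + 2)) K)
        {MvPolynomial.map (algebraMap k K) F} := by
  ext x
  change ({F} : Set _) ⊆ _ ↔ ({MvPolynomial.map (algebraMap k K) F} : Set _) ⊆ _
  rw [Set.singleton_subset_iff, Set.singleton_subset_iff, SetLike.mem_coe, SetLike.mem_coe]
  exact Iff.rfl

variable {k K}
variable (F : MvPolynomial (Fin (n + 2)) k) {d : ℕ} (hF : F.IsHomogeneous d)

local notation "𝒜" => MvPolynomial.homogeneousSubmodule (Fin (n + 2)) k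

include hF in
/-- **Geometric irreducibility of `X_F`** (Hartshorne II Ex. 3.15; Stacks 0366): if `F` stays
irreducible in `K[x₀,…,x_{n+1}]` for every field extension `K/k`, then `X_F = V₊(F) → Spec k` is
geometrically irreducible: `X_F ×ₖ K` embeds as a closed subscheme of `ℙⁿ⁺¹_K` with image the
irreducible `V₊(F_K)`. [cite: Hartshorne1977, II Ex. 3.15] [cite: StacksProject, Tag 0366] -/
theorem geometricallyIrreducible_hypersurface_hom
    (hirr : ∀ (K : Type u) [Field K] [Algebra k K], Irreducible (MvPolynomial.map (algebraMap k K) F)) :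
    GeometricallyIrreducible (hypersurface F).hom := by
  rw [geometricallyIrreducible_iff, geometrically_iff_of_commRing_of_isClosedUnderIsomorphisms]
  intro K _ _
  -- the base-changed closed immersion `jK : X_F ×ₖ K ⟶ ℙⁿ⁺¹_k ×ₖ K`
  have sq := isPullback_baseChange_map_left K (hypersurfaceι F)
  haveI : IsClosedImmersion
      ((Literature.AlgebraicGeometry.Motives.baseChange k K).map (hypersurfaceι F)).left :=
    MorphismProperty.IsStableUnderBaseChange.of_isPullback sq.flip inferInstance
  have hsurj₁ : Function.Surjective sq.isoPullback.hom := sq.isoPullback.hom.homeomorph.surjective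
  -- its image is the preimage of `V₊(F)` under `ℙⁿ⁺¹_k ×ₖ K → ℙⁿ⁺¹_k`
  have hrange :
      Set.range ((Literature.AlgebraicGeometry.Motives.baseChange k K).map (hypersurfaceι F)).left =
        (pullback.fst (projectiveSpace (n + 1) k).hom
          (Spec.map (CommRingCat.ofHom (algebraMap k K)))) ⁻¹'
            ProjectiveSpectrum.zeroLocus 𝒜 {F} := by
    rw [← range_hypersurfaceι F, ← Scheme.Pullback.range_fst, ← sq.isoPullback_hom_fst]
    ext y
    simp only [Set.mem_range, Scheme.Hom.comp_apply]
    constructor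
    · rintro ⟨x, rfl⟩
      exact ⟨_, rfl⟩
    · rintro ⟨x, rfl⟩
      obtain ⟨x', rfl⟩ := hsurj₁ x
      exact ⟨x', rfl⟩
  -- `ℙⁿ⁺¹_k ×ₖ K ≅ ℙⁿ⁺¹_K`, under which that preimage is `V₊(F_K)`
  have hP : IsPullback (Proj.map (ProjBaseChange.mapGraded k K (Fin (n + 2)))
      (ProjBaseChange.irrelevant_le_map k K _)) (projectiveSpace (n + 1) K).hom
      (projectiveSpace (n + 1) k).hom (Spec.map (CommRingCat.ofHom (algebraMap k K))) :=
    ProjBaseChange.isPullback_projMap k K (Fin (n + 2))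
  have hsurj₂ : Function.Surjective hP.isoPullback.hom := hP.isoPullback.hom.homeomorph.surjective
  have hT : hP.isoPullback.hom ⁻¹' ((pullback.fst (projectiveSpace (n + 1) k).hom
        (Spec.map (CommRingCat.ofHom (algebraMap k K)))) ⁻¹'
          ProjectiveSpectrum.zeroLocus 𝒜 {F}) =
      ProjectiveSpectrum.zeroLocus (MvPolynomial.homogeneousSubmodule (Fin (n + 2)) K)
        {MvPolynomial.map (algebraMap k K) F} := by
    ext x
    have hx : (pullback.fst (projectiveSpace (n + 1) k).hom
        (Spec.map (CommRingCat.ofHom (algebraMap k K)))) (hP.isoPullback.hom x) =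
        (Proj.map (ProjBaseChange.mapGraded k K (Fin (n + 2)))
          (ProjBaseChange.irrelevant_le_map k K _)) x :=
      (Scheme.Hom.comp_apply _ _ x).symm.trans (congrArg (fun f => f x) hP.isoPullback_hom_fst)
    calc x ∈ hP.isoPullback.hom ⁻¹' ((pullback.fst (projectiveSpace (n + 1) k).hom
            (Spec.map (CommRingCat.ofHom (algebraMap k K)))) ⁻¹' ProjectiveSpectrum.zeroLocus 𝒜 {F})
        ↔ (pullback.fst (projectiveSpace (n + 1) k).hom
            (Spec.map (CommRingCat.ofHom (algebraMap k K)))) (hP.isoPullback.hom x) ∈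
              ProjectiveSpectrum.zeroLocus 𝒜 {F} := Iff.rfl
      _ ↔ (Proj.map (ProjBaseChange.mapGraded k K (Fin (n + 2)))
            (ProjBaseChange.irrelevant_le_map k K _)) x ∈ ProjectiveSpectrum.zeroLocus 𝒜 {F} :=
          iff_of_eq (congrArg (· ∈ ProjectiveSpectrum.zeroLocus 𝒜 {F}) hx)
      _ ↔ x ∈ ProjectiveSpectrum.zeroLocus (MvPolynomial.homogeneousSubmodule (Fin (n + 2)) K)
            {MvPolynomial.map (algebraMap k K) F} :=
          Set.ext_iff.mp (preimage_projMap_zeroLocus k K F) x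
  -- that image is irreducible
  have hTirr : IsIrreducible
      (Set.range ((Literature.AlgebraicGeometry.Motives.baseChange k K).map (hypersurfaceι F)).left) := by
    have hFK : Prime (MvPolynomial.map (algebraMap k K) F) :=
      UniqueFactorizationMonoid.irreducible_iff_prime.mp (hirr K)
    have H := (isIrreducible_zeroLocus_of_prime _ (hF.map (algebraMap k K)) hFK).image _
      hP.isoPullback.hom.continuous.continuousOn
    have e1 := (congrArg (Set.image hP.isoPullback.hom) hT.symm).trans
      (Set.image_preimage_eq _ hsurj₂)
    exact (congrArg IsIrreducible hrange).mpr ((congrArg IsIrreducible e1).mp H)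
  -- a space admitting a closed embedding onto an irreducible subspace is irreducible
  haveI : IrreducibleSpace
      (Set.range ((Literature.AlgebraicGeometry.Motives.baseChange k K).map (hypersurfaceι F)).left) :=
    Subtype.irreducibleSpace hTirr
  exact ((Literature.AlgebraicGeometry.Motives.baseChange k K).map
    (hypersurfaceι F)).left.isClosedEmbedding.isEmbedding.toHomeomorph.irreducibleSpace_iff.mpr this

end BaseChange

end Literature.AlgebraicGeometry.Motives.SmoothHypersurface

end
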